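import Literature.MathematicalPhysics.QuantumFieldTheory.LatticeGaugeStaticPotentialProofs
import Literature.MathematicalPhysics.QuantumFieldTheory.ConstructiveQFTWave0Proofs
import Literature.MathematicalPhysics.QuantumFieldTheory.LatticeGaugeProofs
import HarnessLib

/-!
# The four-direction chessboard for tilt functionals on the odd four-torus
(stub (C) `stub_tiltChessboard` of crux stmt-QuantumFields-10523, line
line-sparse-defect-orbit-window)

For Wilson's lattice gauge measure `μ_β` of a continuous representation `ρ` of a compact group on
the odd four-torus `(ℤ/(2S+1))⁴` and a fixed plaquette orientation class `o = (i < j)`, the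
exponential tilt functional of a profile `c` on the sites is
`Φ_o(c) := ∫ exp(−∑ₓ c(x) · Re tr ρ(U_{(x,o)})) dμ_β`.
The one-direction (time direction `0`) chessboard estimate
`Φ_o(c)^{2S+1} ≤ ∏ₛ Φ_o(x ↦ c(x[0 := s]))` (stub (B), taken as a hypothesis) is transported to
every direction `k` by the coordinate permutation `(0 k)` of the torus (invariance of the Wilson
state, `wilsonMeasure_map_configPerm`; a plaquette goes to a plaquette, possibly traversed
backwards, and `Re tr ρ(g⁻¹) = Re tr ρ(g)`), and iterated over the four directions:
`Φ_o(c)^{(2S+1)⁴} ≤ ∏_y Φ_o(const (c y))` (Fröhlich–Israel–Lieb–Simon 1978, Theorem 2.2, on the odd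
four-torus).
-/

set_option autoImplicit false

noncomputable section

namespace Summit.QuantumFields.YangMills.Cruxes.LatticeGapOnTrajectory.SparseDefectOrbitWindow

open scoped BigOperators
open MeasureTheory Literature.MathematicalPhysics.QuantumFieldTheory

/-! ## Abstract iteration: four one-direction steps and the re-indexing of the fourfold product -/

/-- One lift of a chessboard step through a product: if `0 ≤ a ≤ ∏ᵢ fᵢ` with `fᵢ ≥ 0` and
`fᵢ ^ n ≤ ∏ₖ g i k`, then `a ^ n ≤ ∏_{(i,k)} g i k`. -/
theorem pow_le_prod_prod_of_le_prod {ι κ : Type*} [Fintype ι] [Fintype κ] {n : ℕ} {a : ℝ}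
    {f : ι → ℝ} {g : ι → κ → ℝ} (ha : 0 ≤ a) (hle : a ≤ ∏ i, f i) (hf : ∀ i, 0 ≤ f i)
    (hfg : ∀ i, f i ^ n ≤ ∏ k, g i k) :
    a ^ n ≤ ∏ p : ι × κ, g p.1 p.2 := by
  rw [Fintype.prod_prod_type']
  calc a ^ n ≤ (∏ i, f i) ^ n := pow_le_pow_left₀ ha hle n
    _ = ∏ i, f i ^ n := (Finset.prod_pow _ _ _).symm
    _ ≤ ∏ i, ∏ k, g i k := Finset.prod_le_prod (fun i _ => pow_nonneg (hf i) n) fun i _ => hfg i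

/-- Updating all four coordinates of a site gives the site with the prescribed coordinates. -/
theorem update_four_eq_vec {α : Type*} (x : Fin 4 → α) (s₀ s₁ s₂ s₃ : α) :
    Function.update (Function.update (Function.update (Function.update x 3 s₃) 2 s₂) 1 s₁) 0 s₀ =
      ![s₀, s₁, s₂, s₃] := by
  funext j
  fin_cases j <;> rfl

/-- **Abstract four-direction iteration.** If a nonnegative functional `Φ` of profiles on the
four-torus of side `n` satisfies the one-direction chessboard step
`Φ(e)^n ≤ ∏ₛ Φ(x ↦ e(x[k := s]))` in every direction `k` for every admissible profile (an
admissibility predicate `P` stable under precomposition), then `Φ(c)^{n⁴} ≤ ∏_y Φ(const (c y))`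
for every admissible `c`. -/
theorem pow_pow_four_le_prod_const {n : ℕ} [NeZero n] (Φ : ((Fin 4 → ZMod n) → ℝ) → ℝ)
    (P : ((Fin 4 → ZMod n) → ℝ) → Prop) (hnn : ∀ e, P e → 0 ≤ Φ e)
    (hP : ∀ e, P e → ∀ g : (Fin 4 → ZMod n) → (Fin 4 → ZMod n), P (fun x => e (g x)))
    (hstep : ∀ e, P e → ∀ k : Fin 4,
      Φ e ^ n ≤ ∏ s : ZMod n, Φ (fun x => e (Function.update x k s)))
    (c : (Fin 4 → ZMod n) → ℝ) (hc : P c) :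
    Φ c ^ (n ^ 4) ≤ ∏ y : Fin 4 → ZMod n, Φ (fun _ => c y) := by
  have h1 : Φ c ^ n ≤ ∏ s : ZMod n, Φ (fun x => c (Function.update x 0 s)) := hstep c hc 0
  have h2 : (Φ c ^ n) ^ n ≤ ∏ p : ZMod n × ZMod n,
      Φ (fun x => c (Function.update (Function.update x 1 p.2) 0 p.1)) :=
    pow_le_prod_prod_of_le_prod
      (g := fun s t => Φ (fun x => c (Function.update (Function.update x 1 t) 0 s)))
      (pow_nonneg (hnn c hc) n) h1 (fun s => hnn _ (hP c hc _)) fun s => hstep _ (hP c hc _) 1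
  have h3 : ((Φ c ^ n) ^ n) ^ n ≤ ∏ p : (ZMod n × ZMod n) × ZMod n,
      Φ (fun x => c (Function.update (Function.update (Function.update x 2 p.2) 1 p.1.2)
        0 p.1.1)) :=
    pow_le_prod_prod_of_le_prod
      (g := fun (p : ZMod n × ZMod n) t => Φ (fun x =>
        c (Function.update (Function.update (Function.update x 2 t) 1 p.2) 0 p.1)))
      (pow_nonneg (pow_nonneg (hnn c hc) n) n) h2 (fun p => hnn _ (hP c hc _))
      fun p => hstep _ (hP c hc _) 2
  have h4 : (((Φ c ^ n) ^ n) ^ n) ^ n ≤ ∏ p : ((ZMod n × ZMod n) × ZMod n) × ZMod n,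
      Φ (fun x => c (Function.update (Function.update (Function.update (Function.update x 3 p.2)
        2 p.1.2) 1 p.1.1.2) 0 p.1.1.1)) :=
    pow_le_prod_prod_of_le_prod
      (g := fun (p : (ZMod n × ZMod n) × ZMod n) t => Φ (fun x =>
        c (Function.update (Function.update (Function.update (Function.update x 3 t) 2 p.2)
          1 p.1.2) 0 p.1.1)))
      (pow_nonneg (pow_nonneg (pow_nonneg (hnn c hc) n) n) n) h3 (fun p => hnn _ (hP c hc _))
      fun p => hstep _ (hP c hc _) 3
  have hn : n ^ 4 = n * n * n * n := by ring
  rw [hn, pow_mul, pow_mul, pow_mul]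
  refine h4.trans_eq (Fintype.prod_equiv
    ⟨fun p => ![p.1.1.1, p.1.1.2, p.1.2, p.2], fun y => (((y 0, y 1), y 2), y 3), fun p => rfl,
      fun y => ?_⟩ _ _ fun p => ?_)
  · funext j
    fin_cases j <;> rfl
  · simp only [Equiv.coe_fn_mk, update_four_eq_vec]

/-! ## Coordinate permutations of the torus and the tilt functionals -/

/-- `sitePerm π` undoes `sitePerm π⁻¹`. -/
theorem sitePerm_apply_sitePerm_symm {d L : ℕ} (π : Equiv.Perm (Fin d)) (x : Site d L) :
    sitePerm π (sitePerm π.symm x) = x := by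
  funext j
  simp only [sitePerm_apply, Equiv.symm_symm, Equiv.apply_symm_apply]

/-- `sitePerm` intertwines the coordinate updates: `π (x[i := s]) = (π x)[π i := s]`. -/
theorem sitePerm_update {d L : ℕ} (π : Equiv.Perm (Fin d)) (x : Site d L) (i : Fin d)
    (s : ZMod L) :
    sitePerm π (Function.update x i s) = Function.update (sitePerm π x) (π i) s := by
  funext j
  simp only [sitePerm_apply, Function.update_apply, Equiv.symm_apply_eq]

/-- A coordinate permutation carries the plaquette function `Re tr ρ(U_{(x,o)})` of one
orientation class to that of another class at the permuted site (a plaquette goes to a plaquette,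
possibly traversed backwards, and `Re tr ρ(g⁻¹) = Re tr ρ(g)` for a continuous representation of a
compact group). -/
theorem exists_plaqRe_configPerm {d L N : ℕ} {G : Type*} [Group G] [TopologicalSpace G]
    [IsTopologicalGroup G] [CompactSpace G] [MeasurableSpace G]
    (ρ : G →* Matrix (Fin N) (Fin N) ℂ) (hρ : Continuous ρ) (π : Equiv.Perm (Fin d))
    (o : {q : Fin d × Fin d // q.1 < q.2}) :
    ∃ o' : {q : Fin d × Fin d // q.1 < q.2}, ∀ (U : GaugeConfig d L G) (x : Site d L),
      WilsonRP.plaqRe ρ (configPerm π U) (x, o) = WilsonRP.plaqRe ρ U (sitePerm π.symm x, o') := by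
  obtain ⟨⟨i, j⟩, hij⟩ := o
  rcases lt_trichotomy (π.symm i) (π.symm j) with h | h | h
  · exact ⟨⟨(π.symm i, π.symm j), h⟩, fun U x => by
      simp only [WilsonRP.plaqRe, plaquetteHolonomy_configPerm]⟩
  · exact absurd (π.symm.injective h) hij.ne
  · refine ⟨⟨(π.symm j, π.symm i), h⟩, fun U x => ?_⟩
    simp only [WilsonRP.plaqRe, plaquetteHolonomy_configPerm]
    rw [plaquetteHolonomy_swap U _ (π.symm j) (π.symm i),
      Literature.RepresentationTheory.CompactGroups.CompactGroup.re_trace_map_inv ρ hρ]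

/-- **Transport of the tilt functionals under a coordinate permutation**: by the invariance of the
Wilson state under `configPerm π`, the tilt functional of class `o` and profile `c` equals the tilt
functional of the permuted class `o'` and the profile `c ∘ sitePerm π`. -/
theorem tilt_integral_configPerm {L N : ℕ} [NeZero L] {G : Type*} [Group G] [TopologicalSpace G]
    [IsTopologicalGroup G] [CompactSpace G] [MeasurableSpace G] [BorelSpace G]
    (ρ : G →* Matrix (Fin N) (Fin N) ℂ) (hρ : Continuous ρ) (β : ℝ) (π : Equiv.Perm (Fin 4))
    (o o' : {q : Fin 4 × Fin 4 // q.1 < q.2})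
    (ho : ∀ (U : GaugeConfig 4 L G) (x : Site 4 L),
      WilsonRP.plaqRe ρ (configPerm π U) (x, o) = WilsonRP.plaqRe ρ U (sitePerm π.symm x, o'))
    (c : Site 4 L → ℝ) :
    ∫ U, Real.exp (-∑ x : Site 4 L, c x * WilsonRP.plaqRe ρ U (x, o))
        ∂(wilsonMeasure ρ β : Measure (GaugeConfig 4 L G)) =
      ∫ U, Real.exp (-∑ x : Site 4 L, c (sitePerm π x) * WilsonRP.plaqRe ρ U (x, o'))
        ∂(wilsonMeasure ρ β : Measure (GaugeConfig 4 L G)) := by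
  calc ∫ U, Real.exp (-∑ x : Site 4 L, c x * WilsonRP.plaqRe ρ U (x, o))
        ∂(wilsonMeasure ρ β : Measure (GaugeConfig 4 L G))
      = ∫ U, Real.exp (-∑ x : Site 4 L, c x * WilsonRP.plaqRe ρ U (x, o))
          ∂((wilsonMeasure ρ β : Measure (GaugeConfig 4 L G)).map (configPerm π)) := by
        rw [wilsonMeasure_map_configPerm ρ hρ β π]
    _ = ∫ U, Real.exp (-∑ x : Site 4 L, c x * WilsonRP.plaqRe ρ (configPerm π U) (x, o))
          ∂(wilsonMeasure ρ β : Measure (GaugeConfig 4 L G)) := integral_map_equiv _ _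
    _ = ∫ U, Real.exp (-∑ x : Site 4 L, c (sitePerm π x) * WilsonRP.plaqRe ρ U (x, o'))
          ∂(wilsonMeasure ρ β : Measure (GaugeConfig 4 L G)) := by
        refine integral_congr_ae (ae_of_all _ fun U => ?_)
        simp only [ho]
        refine congrArg (fun t : ℝ => Real.exp (-t)) ?_
        refine Fintype.sum_equiv (sitePerm π.symm) _ _ fun x => ?_
        simp only [sitePerm_apply_sitePerm_symm]

/-- **The one-direction chessboard step in an arbitrary direction `k`** from the step in the time
direction `0`: transport by the coordinate exchange `(0 k)`. -/
theorem tiltStep_dir {S N : ℕ} {G : Type} [Group G] [TopologicalSpace G] [IsTopologicalGroup G]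
    [CompactSpace G] [MeasurableSpace G] [BorelSpace G] (ρ : G →* Matrix (Fin N) (Fin N) ℂ)
    (hρ : Continuous ρ) (β : ℝ)
    (hB : ∀ (o : {q : Fin 4 × Fin 4 // q.1 < q.2}) (c : Site 4 (2 * S + 1) → ℝ),
      (∀ x, 0 ≤ c x) → (∀ x, c x ≤ β) →
      (∫ U, Real.exp (-∑ x : Site 4 (2 * S + 1), c x * WilsonRP.plaqRe ρ U (x, o))
          ∂(wilsonMeasure ρ β : Measure (GaugeConfig 4 (2 * S + 1) G))) ^ (2 * S + 1) ≤
        ∏ s : ZMod (2 * S + 1),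
          ∫ U, Real.exp (-∑ x : Site 4 (2 * S + 1),
              c (Function.update x 0 s) * WilsonRP.plaqRe ρ U (x, o))
            ∂(wilsonMeasure ρ β : Measure (GaugeConfig 4 (2 * S + 1) G)))
    (k : Fin 4) (o : {q : Fin 4 × Fin 4 // q.1 < q.2}) (c : Site 4 (2 * S + 1) → ℝ)
    (hc0 : ∀ x, 0 ≤ c x) (hcβ : ∀ x, c x ≤ β) :
    (∫ U, Real.exp (-∑ x : Site 4 (2 * S + 1), c x * WilsonRP.plaqRe ρ U (x, o))
        ∂(wilsonMeasure ρ β : Measure (GaugeConfig 4 (2 * S + 1) G))) ^ (2 * S + 1) ≤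
      ∏ s : ZMod (2 * S + 1),
        ∫ U, Real.exp (-∑ x : Site 4 (2 * S + 1),
            c (Function.update x k s) * WilsonRP.plaqRe ρ U (x, o))
          ∂(wilsonMeasure ρ β : Measure (GaugeConfig 4 (2 * S + 1) G)) := by
  obtain ⟨o', ho'⟩ :=
    exists_plaqRe_configPerm (L := 2 * S + 1) ρ hρ (Equiv.swap (0 : Fin 4) k) o
  have hT := fun e : Site 4 (2 * S + 1) → ℝ =>
    tilt_integral_configPerm ρ hρ β (Equiv.swap (0 : Fin 4) k) o o' ho' e
  rw [hT c]
  refine (hB o' (fun x => c (sitePerm (Equiv.swap (0 : Fin 4) k) x)) (fun x => hc0 _)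
    (fun x => hcβ _)).trans_eq (Finset.prod_congr rfl fun s _ => ?_)
  rw [hT (fun x => c (Function.update x k s))]
  simp only [sitePerm_update, Equiv.swap_apply_left]

/-- **(C) stub_tiltChessboard** — THE FOUR-DIRECTION CHESSBOARD FOR TILT FUNCTIONALS (FILS 1978
Thm 2.2 on the odd four-torus), from the one-direction step (B):
`Φ(c)^{(2S+1)⁴} ≤ ∏_y Φ(const (c y))`. The step in direction `k` is the step in direction `0` for
`configPerm (Equiv.swap 0 k)`-transported data; iterate over `k = 0, 1, 2, 3` and re-index
`(s₀, s₁, s₂, s₃) ↔ y`. -/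
theorem stub_tiltChessboard :
    (∀ (S N : ℕ) (G : Type) [Group G] [TopologicalSpace G] [IsTopologicalGroup G] [CompactSpace G]
      [MeasurableSpace G] [BorelSpace G] (ρ : G →* Matrix (Fin N) (Fin N) ℂ), 1 ≤ S → Continuous ρ →
      ∀ (β : ℝ), 0 ≤ β → ∀ (o : {q : Fin 4 × Fin 4 // q.1 < q.2}) (c : Site 4 (2 * S + 1) → ℝ),
        (∀ x, 0 ≤ c x) → (∀ x, c x ≤ β) →
        (∫ U, Real.exp (-∑ x : Site 4 (2 * S + 1), c x * WilsonRP.plaqRe ρ U (x, o))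
            ∂(wilsonMeasure ρ β : Measure (GaugeConfig 4 (2 * S + 1) G))) ^ (2 * S + 1) ≤
          ∏ s : ZMod (2 * S + 1),
            ∫ U, Real.exp (-∑ x : Site 4 (2 * S + 1),
                c (Function.update x 0 s) * WilsonRP.plaqRe ρ U (x, o))
              ∂(wilsonMeasure ρ β : Measure (GaugeConfig 4 (2 * S + 1) G))) →
    ∀ (S N : ℕ) (G : Type) [Group G] [TopologicalSpace G] [IsTopologicalGroup G] [CompactSpace G]
      [MeasurableSpace G] [BorelSpace G] (ρ : G →* Matrix (Fin N) (Fin N) ℂ), 1 ≤ S → Continuous ρ →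
    ∀ (β : ℝ), 0 ≤ β → ∀ (o : {q : Fin 4 × Fin 4 // q.1 < q.2}) (c : Site 4 (2 * S + 1) → ℝ),
      (∀ x, 0 ≤ c x) → (∀ x, c x ≤ β) →
      (∫ U, Real.exp (-∑ x : Site 4 (2 * S + 1), c x * WilsonRP.plaqRe ρ U (x, o))
          ∂(wilsonMeasure ρ β : Measure (GaugeConfig 4 (2 * S + 1) G))) ^ ((2 * S + 1) ^ 4) ≤
        ∏ y : Site 4 (2 * S + 1),
          ∫ U, Real.exp (-∑ x : Site 4 (2 * S + 1), c y * WilsonRP.plaqRe ρ U (x, o))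
            ∂(wilsonMeasure ρ β : Measure (GaugeConfig 4 (2 * S + 1) G)) := by
  intro hB S N G _ _ _ _ _ _ ρ hS hρ β hβ o c hc0 hcβ
  exact pow_pow_four_le_prod_const
    (fun e => ∫ U, Real.exp (-∑ x : Site 4 (2 * S + 1), e x * WilsonRP.plaqRe ρ U (x, o))
      ∂(wilsonMeasure ρ β : Measure (GaugeConfig 4 (2 * S + 1) G)))
    (fun e => (∀ x, 0 ≤ e x) ∧ (∀ x, e x ≤ β))
    (fun e _ => integral_nonneg fun U => (Real.exp_pos _).le)
    (fun e he g => ⟨fun x => he.1 (g x), fun x => he.2 (g x)⟩)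
    (fun e he k => tiltStep_dir ρ hρ β (hB S N G ρ hS hρ β hβ) k o e he.1 he.2)
    c ⟨hc0, hcβ⟩

end Summit.QuantumFields.YangMills.Cruxes.LatticeGapOnTrajectory.SparseDefectOrbitWindow

end
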